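import Literature.Analysis.FluidPDE.FluidComputer.TubeCertificate
import Literature.Analysis.FluidPDE.FluidComputer.ThresholdLevelChain
import Literature.Analysis.FluidPDE.FluidComputer.SpecArithmetic
import Literature.Analysis.FluidPDE.Tao2016AveragedNS.ReachCovariance
import HarnessLib

/-!
# The tube certificate as a cascade stage: typed in the reach layer's currency, transported to
every level, chained through the design hand-off — and what that hand-off idealises

HONEST FRAMING (cell `pub-fluidc`, blueprint seat bp3, gen 14): low prior, high value-of-information
experiment on Tao's machine paradigm; NOT a claim that NS blows up. Everything here concerns the
5-mode quadratic, energy-conserving TRUNCATION `thresholdCircuit` (a superposition of the gates of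
[Tao2016AveragedNS, §5]) with an ABSTRACT forcing of sup-size `δ`; nothing is proved about the
Navier–Stokes equations, and the cascade-level statements below are about the idealised design
hand-off, whose idealisations are listed in §4.

What is new relative to `TubeCertificate` (gen 13, the kernel-checked tube run
`TubeTable.inputBox_reach_outputLoaded`):

* §1 `TubeStage.stageOfReachFree`, `TubeStage.inputBoxStage` — the tube run packaged as an
  inhabitant of the cell's reach interface `ReachCertificate` over the WHOLE mode space (no ambient
  working region: confinement to the energy cube is derived from the energy budget by
  `IsForcedWindow.quiet`), with input region the certified input box, output region the half-space
  `outputAbove zL = {ã ≥ 0.9604}` (the output is loaded AND has the design sign), defect `Gt.δ`,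
  cycle time `Tcyc = T12t + T₃L ≤ 1.4142`, tube = the energy tube.
* §2 `TubeStage.inputBoxStageLevel`, `TubeStage.inputBoxCone` — the same stage at every amplitude
  level `c > 0` (bp1's `certificateRescale` along `thresholdCircuit_smul`: defect `c²·Gt.δ`, cycle
  `Tcyc/c`), and ONE certificate for the whole cone of levels `c ≥ c₀ ≥ 1` at fixed defect
  `c₀²·Gt.δ` (the union of the level certificates glued by the energy tube).
* §3 (companion file `TubeStageHandOff.lean`, split off for the topic dir's 400-line rule)
  `TubeStage.handOff_image_cone_subset`, `TubeStage.inputBoxCone_chains` — the design hand-off of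
  [Tao2016AveragedNS, §6.1] (`handOff zL`: the output mode becomes the next carrier, re-read in units
  of the output floor `zL`, fresh modes empty) maps the output cone INTO the input cone of the same
  level, so the cone certificate chains with itself generation after generation with non-decreasing
  level; `eta_cert_ge`, `alphaEff_ge_two_of_eta` — the certified per-generation energy fraction
  `EoutL/(1 + 3·10⁻⁵) ≥ 0.9223` lies in the blueprint's spec window (`α_eff ≥ 2 ⟺ η ≥ 1/2`).
* §4 (companion file) `TubeStage.handOff_fresh_modes` + docstring — THE HAND-OFF AUDIT: what `handOff` erases, with
  the numbers of the coupled two-gate experiment (bp3 gen 14 `code/thgate/g14/chain.py`).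

PLACEMENT: cell-own results of `pub-fluidc` (topic `FluidComputer` under the host summit, per the hub's
2026-08-19 placement rule: new work under `Summits/<Summit>/<topic>/`, `Literature/` only for cited
published results); the vocabulary (`ReachCertificate`, `thresholdCircuit`, `IsForcedWindow`,
`energyTube`, `TubeTable.InputBox`, `coneFrom`, `handOff`, `certificateRescale`) is the Literature one,
opened below. No named facts (D-0026); 0 sorry.

[cite: Tao2016AveragedNS, §5.5 Thm 5.3 (5.5); §6.1 (6.1), (6.4), Remark 6.1]
-/

noncomputable section

open Set Filter Topology
open scoped Pointwise

namespace Summit.NavierStokesRegularity.FluidComputer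

open Literature.Analysis.FluidPDE.Tao2016AveragedNS
open Literature.Analysis.FluidPDE.FluidComputer
open Literature.Analysis.FluidPDE.FluidComputer.TubeTable
open Literature.Analysis.FluidPDE.FluidComputer.ThresholdLevelTable (Gt Gt_valid Rbt)
open Literature.Analysis.FluidPDE.FluidComputer.ThresholdLevelTableL (T₃L EoutL)

namespace TubeStage

/-! ### §0. Constants of the stage -/

/-- The cycle time of the certified stage: tube run `T12t` plus level chain `T₃L` (`≤ 1.4142`).
[folklore] -/
def Tcyc : ℝ := T12t + T₃L

/-- The output FLOOR amplitude `zL = 0.9604` (`zL² ≤ EoutL`): the unit in which the next generation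
re-reads its carrier. [folklore] -/
def zL : ℝ := 9604 / 10000

/-- **Output above a level**: the half-space `{ã ≥ z}` (loaded output WITH the design sign).
[folklore] -/
def outputAbove (z : ℝ) : Set (Fin 5 → ℝ) := {X | z ≤ X 4}

/-- [folklore] -/
theorem mem_outputAbove {z : ℝ} {X : Fin 5 → ℝ} : X ∈ outputAbove z ↔ z ≤ X 4 := Iff.rfl

/-- `zL² ≤ EoutL`. [folklore] -/
theorem zL_sq_le_EoutL : zL ^ 2 ≤ EoutL := by norm_num [zL, EoutL]

/-- `0 < zL`. [folklore] -/
theorem zL_pos : 0 < zL := by norm_num [zL]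

/-- `0 < Tcyc`, `Tcyc ≤ 1.4142`. [folklore] -/
theorem Tcyc_pos : 0 < Tcyc := by norm_num [Tcyc, T12t, T₃L]

/-- [folklore] -/
theorem Tcyc_le : Tcyc ≤ 1.4142 := certificate_numbers.2.2.1

/-- The output coordinate on the input box: `|ã| ≤ 10⁻⁵`. [folklore] -/
theorem abs_output_le_of_mem_inputBox {X : Fin 5 → ℝ} (hX : X ∈ InputBox) : |X 4| ≤ 1 / 10 ^ 5 := by
  obtain ⟨-, -, -, gV⟩ := hX
  simp only [TubeBoxD.toR, B0t] at gV
  push_cast at gV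
  rw [abs_le]
  constructor <;> nlinarith [sq_nonneg (X 3), sq_nonneg (X 4 + 1 / 10 ^ 5), sq_nonneg (X 4 - 1 / 10 ^ 5)]

/-- **The energy budget of the stage**: on the input box, `E(p) + 10·Gt.δ·Rbt·Tcyc < Rbt²`
(`E ≤ 1 + 3·10⁻⁵`, drift `≤ 6·10⁻⁵`, `Rbt² ≥ 1.06`). [folklore] -/
theorem inputBox_energy_budget {p : Fin 5 → ℝ} (hp : p ∈ InputBox) :
    energy p + 10 * (Gt.δ * Rbt) * Tcyc < Rbt ^ 2 := by
  have hE := certificate_numbers.2.2.2 p hp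
  have hdr : 10 * (Gt.δ * Rbt) * Tcyc ≤ 6 / 10 ^ 5 := by
    have h1 : 10 * (Gt.δ * Rbt) ≤ 4 / 10 ^ 5 := by norm_num [Gt, Rbt]
    have h2 := Tcyc_le
    have h3 := Tcyc_pos
    nlinarith
  have hRb2 : (106 : ℝ) / 100 ≤ Rbt ^ 2 := by norm_num [Rbt]
  linarith

/-- **REACH with the design sign.** Every forced window of defect `≤ Gt.δ` on `[0, Tcyc]` from the
input box reaches `ã ≥ zL = 0.9604` (not merely `ã² ≥ EoutL`): the output floor `ã(t) ≥ ã(0) - δt`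
(`output_ge_affine`) excludes the negative root. [cite: Tao2016AveragedNS, §5.5 Thm 5.3 (5.5)] -/
theorem inputBox_reach_outputAbove {y : ℝ → Fin 5 → ℝ}
    (hW : IsForcedWindow Gt.ε Gt.σ Gt.ν Gt.μ Gt.r Gt.κ Gt.δ Tcyc y) (h0 : y 0 ∈ InputBox) :
    ∃ s ∈ Icc 0 Tcyc, y s ∈ outputAbove zL := by
  obtain ⟨s, hs, hsq⟩ := inputBox_reach_outputLoaded' hW h0
  refine ⟨s, hs, ?_⟩
  have hfl := hW.output_ge_affine (by norm_num [Gt]) s hs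
  have h4 := (abs_le.1 (abs_output_le_of_mem_inputBox h0)).1
  have hδs : Gt.δ * s ≤ 1 / 10 ^ 5 := by
    have h1 : Gt.δ ≤ 4 / 10 ^ 6 := by norm_num [Gt]
    have h2 : s ≤ 1.4142 := hs.2.trans Tcyc_le
    have h3 : (0 : ℝ) ≤ Gt.δ := by norm_num [Gt]
    nlinarith [hs.1]
  have hlow : -(2 / 10 ^ 5 : ℝ) ≤ y s 4 := by linarith
  rw [mem_outputAbove]
  by_contra hlt
  rw [not_le] at hlt
  have hz := zL_sq_le_EoutL
  have hE : (0.9224 : ℝ) ≤ EoutL := certificate_numbers.1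
  by_cases hnn : 0 ≤ y s 4
  · have : y s 4 ^ 2 < zL ^ 2 := by nlinarith [zL_pos]
    linarith
  · rw [not_le] at hnn
    have : y s 4 ^ 2 ≤ (2 / 10 ^ 5) ^ 2 := by nlinarith
    norm_num at this
    linarith

/-! ### §1. The stage in the reach layer's currency, with no ambient working region -/

/-- **A STAGE OVER THE WHOLE MODE SPACE FROM AN ENERGY BUDGET AND A REACH THEOREM.** For the
threshold circuit (`κ ≥ 0`, defect `δ ≥ 0`), an energy budget `E(p) + 10δR_b·T < R_b²` on the
input region and a reach theorem for forced windows of length `T` give a `ReachCertificate` with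
working region `univ`: AVOID is vacuous, confinement to the cube `|xᵢ| < R_b` and the energy tube
are CONSEQUENCES (`IsForcedWindow.quiet`, `IsForcedWindow.mem_energyTube`). The `univ` region is
what makes level transport and cones possible (§2). [cite: Tao2016AveragedNS, §5.5 Thm 5.3 (5.5)] -/
def stageOfReachFree (ε σ ν μ r κ δ Rb T : ℝ) (Ain Aout : Set (Fin 5 → ℝ))
    (hκ : 0 ≤ κ) (hδ : 0 ≤ δ) (hRb : 0 < Rb)
    (hE : ∀ p ∈ Ain, energy p + 10 * (δ * Rb) * T < Rb ^ 2)
    (hreach : ∀ p ∈ Ain, ∀ x : ℝ → Fin 5 → ℝ, x 0 = p → IsForcedWindow ε σ ν μ r κ δ T x →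
      ∃ t ∈ Icc 0 T, x t ∈ Aout) :
    ReachCertificate (thresholdCircuit ε σ ν μ r κ) univ δ T Ain Aout where
  Tube p t := energyTube δ Rb p t
  Tube_closed p _ := isClosed_energyTube_graph δ Rb T p
  Tube_zero p _ := self_mem_energyTube_zero δ Rb p
  Tube_sub _ _ _ _ := subset_univ _
  cert p hp σT x h0 hσT hx0 hcont _hU hder := by
    have hW : IsForcedWindow ε σ ν μ r κ δ σT x := ⟨hcont, hder⟩
    have hEσ : energy (x 0) + 10 * (δ * Rb) * σT < Rb ^ 2 := by
      rw [hx0]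
      have h1 := hE p hp
      have h2 : 10 * (δ * Rb) * σT ≤ 10 * (δ * Rb) * T :=
        mul_le_mul_of_nonneg_left hσT (by positivity)
      linarith
    have hq := hW.quiet h0 hδ hRb hEσ
    refine ⟨?_, fun hEq => ?_⟩
    · rw [← hx0]
      exact hW.mem_energyTube hκ hRb.le (fun t ht i => ((hq t ⟨ht.1, ht.2.le⟩).2 i).le) σT
        ⟨h0, le_rfl⟩
    · subst hEq
      exact hreach p hp x hx0 hW

/-- The tube of `stageOfReachFree` is the energy tube. [folklore] -/
theorem stageOfReachFree_tube (ε σ ν μ r κ δ Rb T : ℝ) (Ain Aout : Set (Fin 5 → ℝ))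
    (hκ : 0 ≤ κ) (hδ : 0 ≤ δ) (hRb : 0 < Rb)
    (hE : ∀ p ∈ Ain, energy p + 10 * (δ * Rb) * T < Rb ^ 2)
    (hreach : ∀ p ∈ Ain, ∀ x : ℝ → Fin 5 → ℝ, x 0 = p → IsForcedWindow ε σ ν μ r κ δ T x →
      ∃ t ∈ Icc 0 T, x t ∈ Aout) (p : Fin 5 → ℝ) (t : ℝ) :
    (stageOfReachFree ε σ ν μ r κ δ Rb T Ain Aout hκ hδ hRb hE hreach).Tube p t =
      energyTube δ Rb p t := rfl

/-- **THE CERTIFIED STAGE OF THE THRESHOLD GATE** (design point `Gt`, A = 2): a reach certificate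
over the whole mode space, defect `Gt.δ ≈ 3.58·10⁻⁶`, cycle `Tcyc ≤ 1.4142`, from the input box
`InputBox` (`|a-1|, |b| ≲ 10⁻⁵`, `0 ≤ c ≤ 10⁻⁷`, `2d² + ã² ≤ 7.5·10⁻¹¹`) to the loaded, correctly
signed output `ã ≥ zL = 0.9604`; tube = energy tube at radius `Rbt`. REACH is the kernel-checked
tube run + level chain of gen 13 (`inputBox_reach_outputLoaded`).
[cite: Tao2016AveragedNS, §5.5 Thm 5.3 (5.5)] -/
def inputBoxStage :
    ReachCertificate (thresholdCircuit Gt.ε Gt.σ Gt.ν Gt.μ Gt.r Gt.κ) univ Gt.δ Tcyc InputBox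
      (outputAbove zL) :=
  stageOfReachFree Gt.ε Gt.σ Gt.ν Gt.μ Gt.r Gt.κ Gt.δ Rbt Tcyc InputBox (outputAbove zL)
    (by norm_num [Gt]) (by norm_num [Gt]) (by norm_num [Rbt]) (fun _ hp => inputBox_energy_budget hp)
    (fun p hp x hx0 hW => inputBox_reach_outputAbove hW (hx0 ▸ hp))

/-- Its tube is the energy tube at radius `Rbt`. [folklore] -/
theorem inputBoxStage_tube (p : Fin 5 → ℝ) (t : ℝ) :
    inputBoxStage.Tube p t = energyTube Gt.δ Rbt p t := rfl

/-- **What the stage says along a curve** (the certificate unfolded): every continuous curve from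
the input box with right derivative `Gt.δ`-close to the design field on `[0, Tcyc)` keeps its
energy within `10·Gt.δ·Rbt·t ≤ 6·10⁻⁵` of the input energy, keeps `ã(t) ≥ ã(0) - Gt.δ·t`, and
reaches `ã ≥ 0.9604` by time `Tcyc ≤ 1.4142`. [cite: Tao2016AveragedNS, §5.5 Thm 5.3 (5.5)] -/
theorem inputBoxStage_spec {y : ℝ → Fin 5 → ℝ} (h0 : y 0 ∈ InputBox)
    (hcont : ContinuousOn y (Icc 0 Tcyc))
    (hder : ∀ s ∈ Ico 0 Tcyc, ∃ W : Fin 5 → ℝ, HasDerivWithinAt y W (Ici s) s ∧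
      ‖W - thresholdCircuit Gt.ε Gt.σ Gt.ν Gt.μ Gt.r Gt.κ (y s)‖ ≤ Gt.δ) :
    (∀ t ∈ Icc 0 Tcyc, |energy (y t) - energy (y 0)| ≤ 10 * (Gt.δ * Rbt) * t ∧
        y 0 4 - Gt.δ * t ≤ y t 4) ∧ ∃ s ∈ Icc 0 Tcyc, zL ≤ y s 4 := by
  have hW : IsForcedWindow Gt.ε Gt.σ Gt.ν Gt.μ Gt.r Gt.κ Gt.δ Tcyc y := ⟨hcont, hder⟩
  refine ⟨fun t ht => ?_, inputBox_reach_outputAbove hW h0⟩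
  have hc := inputBoxStage.cert (y 0) h0 t y ht.1 ht.2 rfl (hcont.mono (Icc_subset_Icc_right ht.2))
    (fun _ _ => mem_univ _) (fun s hs => hder s ⟨hs.1, lt_of_lt_of_le hs.2 ht.2⟩)
  exact hc.1

/-! ### §2. Every level, and the cone of levels -/

/-- Scaling a half-space of outputs: `c • {ã ≥ z} = {ã ≥ c z}` for `c > 0`. [folklore] -/
theorem smul_outputAbove {c : ℝ} (hc : 0 < c) (z : ℝ) :
    c • outputAbove z = outputAbove (c * z) := by
  ext X
  rw [Set.mem_smul_set_iff_inv_smul_mem₀ hc.ne', mem_outputAbove, mem_outputAbove, Pi.smul_apply,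
    smul_eq_mul]
  constructor
  · intro h
    have := mul_le_mul_of_nonneg_left h hc.le
    rwa [← mul_assoc, mul_inv_cancel₀ hc.ne', one_mul] at this
  · intro h
    have := mul_le_mul_of_nonneg_left h (inv_nonneg.2 hc.le)
    rwa [← mul_assoc, inv_mul_cancel₀ hc.ne', one_mul] at this

/-- **THE STAGE AT LEVEL `c`** (any `c > 0`): input `c • InputBox`, output `ã ≥ c·zL`, defect
`c²·Gt.δ`, cycle `Tcyc/c`, over the whole mode space — bp1's `certificateRescale` along the exact
quadratic homogeneity `thresholdCircuit_smul`; no table is re-run.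
[cite: Tao2016AveragedNS, §5.5 Thm 5.3 (5.5); Remark 6.1] -/
def inputBoxStageLevel {c : ℝ} (hc : 0 < c) :
    ReachCertificate (thresholdCircuit Gt.ε Gt.σ Gt.ν Gt.μ Gt.r Gt.κ) univ (c ^ 2 * Gt.δ) (Tcyc / c)
      (c • InputBox) (outputAbove (c * zL)) :=
  certificateCast
    (certificateRescale (thresholdCircuit_smul Gt.ε Gt.σ Gt.ν Gt.μ Gt.r Gt.κ) inputBoxStage hc)
    (smul_univ_fin5 hc.ne') rfl rfl rfl (smul_outputAbove hc zL)

open Classical in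
/-- The level of a point of the input cone (a choice of `c ≥ c₀` with `p = c • q`, `q ∈ InputBox`;
`1` off the cone). [folklore] -/
def coneLevel (c₀ : ℝ) (p : Fin 5 → ℝ) : ℝ :=
  if h : p ∈ coneFrom c₀ InputBox then Classical.choose h else 1

/-- [folklore] -/
theorem coneLevel_spec {c₀ : ℝ} {p : Fin 5 → ℝ} (h : p ∈ coneFrom c₀ InputBox) :
    c₀ ≤ coneLevel c₀ p ∧ ∃ q ∈ InputBox, p = coneLevel c₀ p • q := by
  rw [coneLevel, dif_pos h]
  exact Classical.choose_spec h

/-- **THE CONE CERTIFICATE.** For every floor level `c₀ ≥ 1`, ONE reach certificate over the whole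
mode space, at FIXED defect `c₀²·Gt.δ` and cycle `Tcyc/c₀`, from the input cone
`coneFrom c₀ InputBox` (all `c • q`, `c ≥ c₀`, `q ∈ InputBox`) to the output cone
`coneFrom c₀ (outputAbove zL)`: a point at level `c ≥ c₀` is served by the level-`c` stage (which
tolerates the larger defect `c²·Gt.δ` and finishes by the earlier time `Tcyc/c`), and the tube is
the energy tube at radius `c·Rbt` (membership by `IsForcedWindow.quiet` from the level-`c` energy
budget `c²(1 + 3·10⁻⁵) + 10·c₀²Gt.δ·(c Rbt)·(Tcyc/c₀) < (c Rbt)²`, which holds because `c₀ ≤ c`).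
This is the composable currency of the cascade: louder pulses run the same gate faster and tolerate
more forcing. [cite: Tao2016AveragedNS, §5.5 Thm 5.3 (5.5); §6.1 Remark 6.1] -/
def inputBoxCone {c₀ : ℝ} (hc₀ : 1 ≤ c₀) :
    ReachCertificate (thresholdCircuit Gt.ε Gt.σ Gt.ν Gt.μ Gt.r Gt.κ) univ (c₀ ^ 2 * Gt.δ)
      (Tcyc / c₀) (coneFrom c₀ InputBox) (coneFrom c₀ (outputAbove zL)) where
  Tube p t := energyTube (c₀ ^ 2 * Gt.δ) (coneLevel c₀ p * Rbt) p t
  Tube_closed p _ := isClosed_energyTube_graph _ _ _ p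
  Tube_zero p _ := self_mem_energyTube_zero _ _ p
  Tube_sub _ _ _ _ := subset_univ _
  cert p hp σT x h0 hσT hx0 hcont _hU hder := by
    have hc₀0 : 0 < c₀ := lt_of_lt_of_le one_pos hc₀
    obtain ⟨hc, q, hq, hpq⟩ := coneLevel_spec hp
    set c := coneLevel c₀ p with hcdef
    have hc0 : 0 < c := lt_of_lt_of_le hc₀0 hc
    have hpc : p ∈ c • InputBox := Set.mem_smul_set.2 ⟨q, hq, hpq.symm⟩
    have hδ0 : (0 : ℝ) ≤ Gt.δ := by norm_num [Gt]
    have hRb : (0 : ℝ) < Rbt := by norm_num [Rbt]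
    have hκ : (0 : ℝ) ≤ Gt.κ := by norm_num [Gt]
    have hcR : 0 < c * Rbt := mul_pos hc0 hRb
    have hW : IsForcedWindow Gt.ε Gt.σ Gt.ν Gt.μ Gt.r Gt.κ (c₀ ^ 2 * Gt.δ) σT x := ⟨hcont, hder⟩
    -- the level-`c` energy budget
    have hEσ : energy (x 0) + 10 * (c₀ ^ 2 * Gt.δ * (c * Rbt)) * σT < (c * Rbt) ^ 2 := by
      rw [hx0, hpq, energy_smul']
      have hEq := certificate_numbers.2.2.2 q hq
      have hK : 10 * (Gt.δ * Rbt) * Tcyc ≤ 6 / 10 ^ 5 := by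
        have h1 : 10 * (Gt.δ * Rbt) ≤ 4 / 10 ^ 5 := by norm_num [Gt, Rbt]
        nlinarith [Tcyc_le, Tcyc_pos]
      have hRb2 : (106 : ℝ) / 100 ≤ Rbt ^ 2 := by norm_num [Rbt]
      have hsT : σT * c₀ ≤ Tcyc := (le_div_iff₀ hc₀0).1 hσT
      have hnn : 0 ≤ c₀ * c * (10 * (Gt.δ * Rbt)) :=
        mul_nonneg (mul_nonneg hc₀0.le hc0.le) (mul_nonneg (by norm_num) (mul_nonneg hδ0 hRb.le))
      have hA : 10 * (c₀ ^ 2 * Gt.δ * (c * Rbt)) * σT ≤ c * c * (6 / 10 ^ 5) := by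
        have e1 : 10 * (c₀ ^ 2 * Gt.δ * (c * Rbt)) * σT =
            c₀ * c * (10 * (Gt.δ * Rbt)) * (σT * c₀) := by ring
        have e2 : c₀ * c * (10 * (Gt.δ * Rbt)) * (σT * c₀) ≤ c₀ * c * (10 * (Gt.δ * Rbt)) * Tcyc :=
          mul_le_mul_of_nonneg_left hsT hnn
        have e3 : c₀ * c * (10 * (Gt.δ * Rbt)) * Tcyc = c₀ * c * (10 * (Gt.δ * Rbt) * Tcyc) := by
          ring
        have e4 : c₀ * c * (10 * (Gt.δ * Rbt) * Tcyc) ≤ c₀ * c * (6 / 10 ^ 5) :=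
          mul_le_mul_of_nonneg_left hK (mul_nonneg hc₀0.le hc0.le)
        have e5 : c₀ * c * (6 / 10 ^ 5 : ℝ) ≤ c * c * (6 / 10 ^ 5) :=
          mul_le_mul_of_nonneg_right (mul_le_mul_of_nonneg_right hc hc0.le) (by norm_num)
        linarith
      have hE0 : 0 ≤ energy q := by rw [Ignition.energy_five]; positivity
      have h5 : energy q + 6 / 10 ^ 5 < Rbt ^ 2 := by linarith
      have hc2 : 0 < c * c := mul_pos hc0 hc0
      have h6 : c * c * (energy q + 6 / 10 ^ 5) < c * c * Rbt ^ 2 := mul_lt_mul_of_pos_left h5 hc2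
      nlinarith
    have hq' := hW.quiet h0 (mul_nonneg (sq_nonneg _) hδ0) hcR hEσ
    refine ⟨?_, fun hEq => ?_⟩
    · rw [← hx0]
      exact hW.mem_energyTube hκ hcR.le (fun t ht i => ((hq' t ⟨ht.1, ht.2.le⟩).2 i).le) σT
        ⟨h0, le_rfl⟩
    · -- REACH: the level-`c` stage on the shorter window `[0, Tcyc/c]` with the larger defect
      subst hEq
      have hTc : Tcyc / c ≤ Tcyc / c₀ := div_le_div_of_nonneg_left Tcyc_pos.le hc₀0 hc
      have hle : c₀ ^ 2 * Gt.δ ≤ c ^ 2 * Gt.δ :=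
        mul_le_mul_of_nonneg_right (pow_le_pow_left₀ hc₀0.le hc 2) hδ0
      have hcert := (certificateOfLe (inputBoxStageLevel hc0) hle).cert p hpc (Tcyc / c) x
        (div_nonneg Tcyc_pos.le hc0.le) le_rfl hx0 (hcont.mono (Icc_subset_Icc_right hTc))
        (fun _ _ => mem_univ _) (fun s hs => hder s ⟨hs.1, lt_of_lt_of_le hs.2 hTc⟩)
      obtain ⟨s, hs, hsout⟩ := hcert.2 rfl
      refine ⟨s, ⟨hs.1, hs.2.trans hTc⟩, ?_⟩
      -- `x s ∈ outputAbove (c zL) = c • outputAbove zL ⊆ coneFrom c₀ (outputAbove zL)`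
      rw [← smul_outputAbove hc0] at hsout
      obtain ⟨w, hw, hxw⟩ := Set.mem_smul_set.1 hsout
      exact ⟨c, hc, w, hw, hxw.symm⟩

/-- **The cone certificate from the design level**: floor level `1`, defect exactly `Gt.δ`, cycle
exactly `Tcyc` — every pulse at least as loud as the design pulse is served. [cite: Tao2016AveragedNS, §5.5 Thm 5.3 (5.5); §6.1 Remark 6.1] -/
def inputBoxConeOne :
    ReachCertificate (thresholdCircuit Gt.ε Gt.σ Gt.ν Gt.μ Gt.r Gt.κ) univ Gt.δ Tcyc
      (coneFrom 1 InputBox) (coneFrom 1 (outputAbove zL)) :=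
  certificateCast (inputBoxCone le_rfl) rfl (by rw [one_pow, one_mul]) (div_one _) rfl rfl

/-- The tube of the cone certificate. [folklore] -/
theorem inputBoxCone_tube {c₀ : ℝ} (hc₀ : 1 ≤ c₀) (p : Fin 5 → ℝ) (t : ℝ) :
    (inputBoxCone hc₀).Tube p t = energyTube (c₀ ^ 2 * Gt.δ) (coneLevel c₀ p * Rbt) p t := rfl

end TubeStage

end Summit.NavierStokesRegularity.FluidComputer

end
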